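import Summits.Ventures.YMGap.RobustBall.LayerPathSAWCount
import Summits.Ventures.YMGap.RobustBall.CentreBlindStarWindow
import Summits.Ventures.YMGap.RobustBall.StringTensionCentreBlind
import Literature.Probability.LatticeModels.IsingSAWBoundGraph
import Literature.Probability.RandomPlanarGeometry.SAWConnectiveConstantCubicUpperBound
import HarnessLib

/-!
# RobustBall/CentreBlindSAWRate — the `β`-ladder through the SELF-AVOIDING-WALK COUNTS of `ℤⁿ`: `AreaLawCentreBlind 2 (n+1) β` with the EXPLICIT
# bound `|⟨W_{R×T}⟩| ≤ (A r^T/(1−r))^R`, `r = λ·tanh(2|β|) < 1`, for every certificate `c_ℓ(ℤⁿ) ≤ A λ^ℓ`; abstractly up to `μ(ℤⁿ)·tanh β_W < 1`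
# (`d = 4`: UNCONDITIONALLY up to `4.76·tanh β_W < 1`, `β_W < 0.21326…`, in the computational sequel `CentreBlindSAWRateMemory.lean`)

HONEST FRAMING: venture file of the cell `pub-ymgap` (QuantumFields programme), track Y2 ROBUST-BALL / DS seat ds-4 (g13).  WHAT THIS IS: for
`SU(2)` on the torus `(ℤ/L)^{n+1}` with the Wilson action at tree coupling `β` (`β_W = 2|β|`) plus ANY linkwise centre-blind (indeed any
twist-blind) perturbation `W`, the centre projection + layer decoupling + Griffiths comparison of the tree (`norm_cavg_ψ_two_le_gksExpect_const`,
`gksExpect_const_eq_isingTwoPoint`) bound every rung of the loop by a two-point function of the free Ising ferromagnet at `β_W` on a LAYER of the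
torus, and Fisher's inequality on that graph (tree `isingTwoPoint_free_le_pathSum`, M. E. Fisher 1967) bounds it by `∑_{paths b → t} tanh(β_W)^{|path|}`.
NEW HERE: a path in a layer of the discrete torus LIFTS to a self-avoiding walk of `ℤⁿ` with the same step word (`LayerPathSAWCount.lean`,
`card_layerPaths_le_count`: the paths of length `ℓ` between two sites number at most `c_ℓ(ℤⁿ) = SAW.Zd.count n ℓ`), so every counting certificate
`c_ℓ(ℤⁿ) ≤ A·λ^ℓ` gives `⟨σ_bσ_t⟩_layer ≤ A·r^{dist_j(t,b)}/(1−r)`, `r = λ·tanh β_W` (`norm_cavg_ψ_two_le_sawRate`), whence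
**`su2_abs_wilsonLoop_le_sawRate_pow`**: `|⟨W_{R×T}⟩_{β,W,L}| ≤ (A r^T/(1−r))^R` for every twist-blind `W`, `L ≥ 3`, and the DOOR
**`su2_areaLawCentreBlind_sawRate : 1 ≤ n → 1 ≤ A → (∀ ℓ, c_ℓ(ℤⁿ) ≤ A λ^ℓ) → λ·tanh(2|β|) < 1 → AreaLawCentreBlind 2 (n+1) β`** with ONE explicit
`(C, c) = (A/(1−r) + 1, −log max(r, 1/2))`, plus the limit-state reading `su2_stringTension_sawRate` (`σ ≥ −log r` whenever `σ` exists).  ROWS: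
(i) `c_ℓ ≤ (2n/(2n−1))·(2n−1)^ℓ` (no immediate reversals, tree `count_succ_le`) ⇒ `(2n−1)·tanh β_W < 1` (`d = 4`: `5 tanh β_W < 1`, `β_W < 0.2027`;
`d = 3`: `3 tanh β_W < 1`, `β_W < 0.3466`; `d = 2`: EVERY `β`); (ii) the `d = 4` kernel certificate `c_ℓ(ℤ³) ≤ 2⁴¹·4.76^ℓ` (Pönitz–Tittmann memory 10, `native_decide`) and its
row `4.76·tanh β_W < 1` live in the sequel `CentreBlindSAWRateMemory.lean` (computational); (iii) the abstract door
`μ(ℤⁿ)·tanh(2|β|) < 1 ⇒ AreaLawCentreBlind 2 (n+1) β` (`cₙ^{1/n} → μ`, tree `tendsto_count_rpow`; rate explicit in any `λ > μ`, constant not) and the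
CONDITIONAL row on Pönitz–Tittmann's printed `μ(ℤ³) ≤ 4.7387` (named fact `PT2000_connectiveConstant_three_le`, unproved in the tree):
`β_W < artanh(1/4.7387) = 0.21425…`.
HONEST LABEL: `SU(2)`, centre-blind class; strong-coupling lattice statements on finite tori uniformly in `L`; standard axioms throughout this file;
ceiling of this route `artanh(1/μ(ℤ³)) ≈ 0.2168 < β_c(ℤ³) ≈ 0.2217` (the ceiling of the comparison method, reached non-explicitly by the
Duminil-Copin–Tassion route); nothing continuum / spectral / Clay.

References AS PRINTED: M. E. Fisher, Phys. Rev. 162 (1967) 480 (`tanh(J/kT_c) ≥ 1/μ`); A. Pönitz, P. Tittmann, Electron. J. Combin. 7 (2000) R21,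
Table 2; N. Madras, G. Slade, *The Self-Avoiding Walk* (1993) §1.2; J. Fröhlich, Phys. Lett. B 83 (1979) 195; G. Mack, V. B. Petkova, Ann. Phys. 123
(1979) 442.
-/

noncomputable section

open Finset MeasureTheory
open Literature.MathematicalPhysics.QuantumLattice (fundamentalRep normalisedCharacter HasAreaLawWith HasStringTension LGConfig)
open Literature.MathematicalPhysics.QuantumFieldTheory
open Literature.Probability.RandomPlanarGeometry.SAW.Zd (count connectiveConstant)

namespace Summit.Ventures.YMGap.RobustBall

open ZN ZNFluxW ZTwo

variable {n L : ℕ} [NeZero L]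


/-! ### The SAW-rate two-point bound of the layer and the Wilson-loop bound -/

/-- **SAW-RATE TWO-POINT BOUND OF THE CENTRE-PROJECTED `ℤ₂` LAYER** (`L ≥ 3`, `n ≥ 1`, certificate `c_ℓ(ℤⁿ) ≤ A λ^ℓ` with `A ≥ 1`,
`r = λ·tanh(2|β|) < 1`): for every `H, kT, κ, U, b, t`, `‖E ψ₂(σ_b − σ_t)‖ ≤ A · r^{dist_j(t,b)} / (1 − r)` (Griffiths comparison of the tree, then
Fisher's path bound on the layer graph, then the lift of layer paths to self-avoiding walks of `ℤⁿ`). [cite: Fisher1967, Phys. Rev. 162 (1967) 480] -/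
theorem norm_cavg_ψ_two_le_sawRate (hn : 1 ≤ n) (hL : 3 ≤ L) {β A lam : ℝ} (hA : 1 ≤ A) (hlam : 0 ≤ lam)
    (hcount : ∀ ℓ, (count n ℓ : ℝ) ≤ A * lam ^ ℓ) (hr : lam * Real.tanh (2 * |β|) < 1)
    (gD : Fin 0 → (Plaquette (n + 1) L → ZMod 2) → GaugeConfig (n + 1) L (SUN 2) → ℝ) (U : GaugeConfig (n + 1) L (SUN 2)) (i j : Fin (n + 1))
    (H : Finset (ZMod L)) (kT : Transverse (n + 1) L (ZMod 2) i) (κ : Site (n + 1) L → ZMod 2) (b t : Site (n + 1) L) :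
    ‖FiniteGibbs.cavg (layerWeightW (gS β gD U) i H kT κ) (fun σ => ψ 2 (σ b - σ t))‖ ≤
      A * (lam * Real.tanh (2 * |β|)) ^ jDist j t b / (1 - lam * Real.tanh (2 * |β|)) := by
  classical
  have ht0 : 0 ≤ Real.tanh (2 * |β|) := by
    rw [Real.tanh_eq_sinh_div_cosh]
    exact div_nonneg (Real.sinh_nonneg_iff.2 (by positivity)) (Real.cosh_pos _).le
  have hr0 : 0 ≤ lam * Real.tanh (2 * |β|) := mul_nonneg hlam ht0
  have h1r : 0 < 1 - lam * Real.tanh (2 * |β|) := by linarith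
  refine (norm_cavg_ψ_two_le_gksExpect_const (by omega) β gD U i H kT κ b t).trans ?_
  rw [gksExpect_const_eq_isingTwoPoint (by omega)]
  by_cases hbt : b = t
  · subst hbt
    rw [Literature.Probability.LatticeModels.isingTwoPoint_self, jDist_self, pow_zero, mul_one, le_div_iff₀ h1r]
    linarith
  · exact (Literature.Probability.LatticeModels.isingTwoPoint_free_le_pathSum (layerGraph i H) (by positivity) (Finset.mem_univ b)
      (Finset.mem_univ t) hbt).trans (sum_layerPaths_pow_le hn i j H (by linarith) hlam ht0 hr hcount b t _)

/-- **The induced `ℤ₂` Wilson loop obeys the SAW-rate bound** (`L ≥ 3`, `n ≥ 1`, `i ≠ j`, `2R', 2T ≤ L`): `‖znLoopW‖ ≤ (A r^T/(1−r))^{#selIdx 1 R'}`.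
[folklore] -/
theorem norm_znLoopW_le_sawRate (hn : 1 ≤ n) (hL : 3 ≤ L) {β A lam : ℝ} (hA : 1 ≤ A) (hlam : 0 ≤ lam)
    (hcount : ∀ ℓ, (count n ℓ : ℝ) ≤ A * lam ^ ℓ) (hr : lam * Real.tanh (2 * |β|) < 1)
    (gD : Fin 0 → (Plaquette (n + 1) L → ZMod 2) → GaugeConfig (n + 1) L (SUN 2) → ℝ) (U : GaugeConfig (n + 1) L (SUN 2)) (x : Site (n + 1) L)
    {i j : Fin (n + 1)} (hij : i ≠ j) {R' T : ℕ} (hR : 2 * R' ≤ L) (hT : 2 * T ≤ L) :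
    ‖znLoopW β gD U x i j R' T‖ ≤
      (A * (lam * Real.tanh (2 * |β|)) ^ T / (1 - lam * Real.tanh (2 * |β|))) ^ (selIdx 1 R').card := by
  classical
  unfold znLoopW
  refine norm_cavg_ψ_loopSum_le_of_bound (supp := suppS (fun _ : Fin 0 => (∅ : Finset (Plaquette (n + 1) L)))) (g := gS β gD U)
    ?_ hij (m := 1) ?_ (F := fun D => A * (lam * Real.tanh (2 * |β|)) ^ D / (1 - lam * Real.tanh (2 * |β|))) (fun H kT κ b t => ?_) x hR hT
  · rintro (p | t)
    · intro φ φ' h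
      simp only [gS, Sum.elim_inl]
      rw [h p (by simp [suppS])]
    · exact Fin.elim0 t
  · rintro (p | t) y hy y' hy'
    · simp only [suppS, Sum.elim_inl, iLinks_singleton] at hy hy'
      rw [iDist_eq_zero_of_mem_iSites i p hy hy']; exact Nat.one_pos
    · exact Fin.elim0 t
  · exact norm_cavg_ψ_two_le_sawRate hn hL hA hlam hcount hr gD U i j H kT κ b t

/-- **SAW-RATE WILSON-LOOP BOUND** (`SU(2)`, `L ≥ 3`, `n ≥ 1`, certificate `c_ℓ(ℤⁿ) ≤ A λ^ℓ`, `A ≥ 1`, `r = λ·tanh(2|β|) < 1`): for EVERY twist-blind `W`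
and every non-wrapping `R' × T` loop, `|⟨(1/2) tr U_{R'×T}⟩_{β,W,L}| ≤ (A r^T/(1−r))^{#selIdx 1 R'}`. [cite: Frohlich1979ZN, Eq. (7)–(9)] -/
theorem su2_abs_wilsonLoop_le_sawRate (hn : 1 ≤ n) (hL : 3 ≤ L) {β A lam : ℝ} (hA : 1 ≤ A) (hlam : 0 ≤ lam)
    (hcount : ∀ ℓ, (count n ℓ : ℝ) ≤ A * lam ^ ℓ) (hr : lam * Real.tanh (2 * |β|) < 1)
    (W : Perturbation (n + 1) L 2) (hW : IsTwistBlind W) (x : Site (n + 1) L) {i j : Fin (n + 1)} (hij : i ≠ j) {R' T : ℕ} (hR : 2 * R' ≤ L)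
    (hT : 2 * T ≤ L) :
    |W.expectation (fundamentalRep (Fin 2)) β (wilsonLoop (fundamentalRep (Fin 2)) x i j R' T)| ≤
      (A * (lam * Real.tanh (2 * |β|)) ^ T / (1 - lam * Real.tanh (2 * |β|))) ^ (selIdx 1 R').card :=
  abs_expectation_wilsonLoop_le_of_fluxDefect W (c := W.total) (gD := fun (_ : Fin 0) _ _ => (0 : ℝ))
    (fun k U => by rw [hW k U]; simp) β x i j R' T fun U => norm_znLoopW_le_sawRate hn hL hA hlam hcount hr _ U x hij hR hT

/-- The same bound in the form **`|⟨W_{R'×T}⟩_{β,W,L}| ≤ (K · r^T)^{R'}`**, `K = A/(1−r)`, `r = λ·tanh(2|β|)` (through `|⟨W⟩| ≤ 1` when `K r^T > 1`).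
[folklore] -/
theorem su2_abs_wilsonLoop_le_sawRate_pow (hn : 1 ≤ n) (hL : 3 ≤ L) {β A lam : ℝ} (hA : 1 ≤ A) (hlam : 0 ≤ lam)
    (hcount : ∀ ℓ, (count n ℓ : ℝ) ≤ A * lam ^ ℓ) (hr : lam * Real.tanh (2 * |β|) < 1)
    (W : Perturbation (n + 1) L 2) (hW : IsTwistBlind W) (x : Site (n + 1) L) {i j : Fin (n + 1)} (hij : i ≠ j) {R' T : ℕ} (hR : 2 * R' ≤ L)
    (hT : 2 * T ≤ L) :
    |W.expectation (fundamentalRep (Fin 2)) β (wilsonLoop (fundamentalRep (Fin 2)) x i j R' T)| ≤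
      (A / (1 - lam * Real.tanh (2 * |β|)) * (lam * Real.tanh (2 * |β|)) ^ T) ^ R' := by
  have ht0 : 0 ≤ Real.tanh (2 * |β|) := by
    rw [Real.tanh_eq_sinh_div_cosh]
    exact div_nonneg (Real.sinh_nonneg_iff.2 (by positivity)) (Real.cosh_pos _).le
  set r := lam * Real.tanh (2 * |β|) with hrdef
  have hr0 : 0 ≤ r := mul_nonneg hlam ht0
  have h1r : 0 < 1 - r := by linarith
  set K := A / (1 - r) with hK
  have hK0 : 0 ≤ K := div_nonneg (by linarith) h1r.le
  have hbound := su2_abs_wilsonLoop_le_sawRate hn hL hA hlam hcount hr W hW x hij hR hT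
  have hKr : A * r ^ T / (1 - r) = K * r ^ T := by rw [hK]; ring
  rw [hKr] at hbound
  have hF0 : 0 ≤ K * r ^ T := mul_nonneg hK0 (pow_nonneg hr0 _)
  rcases le_or_gt (K * r ^ T) 1 with hle | hgt
  · exact hbound.trans (pow_le_pow_of_le_one hF0 hle (by simpa using le_mul_card_selIdx Nat.one_pos R'))
  · exact (abs_expectation_wilsonLoop_le_one W β x i j R' T).trans (one_le_pow₀ hgt.le)

/-! ### The door: certificate `c_ℓ(ℤⁿ) ≤ A λ^ℓ` ⟹ `AreaLawCentreBlind 2 (n+1) β` on `λ·tanh(2|β|) < 1`, with explicit `(C, c)` -/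

/-- **THE SAW-RATE DOOR: `c_ℓ(ℤⁿ) ≤ A λ^ℓ` (`A ≥ 1`), `λ·tanh(2|β|) < 1` ⇒ `AreaLawCentreBlind 2 (n+1) β`** (`n ≥ 1`), with ONE explicit pair
`c = −log max(r, 1/2)`, `C = A/(1−r) + 1`, `r = λ·tanh(2|β|)`. [cite: MackPetkova1979, §2] -/
theorem su2_areaLawCentreBlind_sawRate (hn : 1 ≤ n) {β A lam : ℝ} (hA : 1 ≤ A) (hlam : 0 ≤ lam)
    (hcount : ∀ ℓ, (count n ℓ : ℝ) ≤ A * lam ^ ℓ) (hr : lam * Real.tanh (2 * |β|) < 1) : AreaLawCentreBlind 2 (n + 1) β := by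
  have ht0 : 0 ≤ Real.tanh (2 * |β|) := by
    rw [Real.tanh_eq_sinh_div_cosh]
    exact div_nonneg (Real.sinh_nonneg_iff.2 (by positivity)) (Real.cosh_pos _).le
  set r := lam * Real.tanh (2 * |β|) with hrdef
  have hr0 : 0 ≤ r := mul_nonneg hlam ht0
  have h1r : 0 < 1 - r := by linarith
  set K := A / (1 - r) with hK
  have hK1 : 1 ≤ K := by
    rw [hK, le_div_iff₀ h1r]
    linarith
  set c₀ := max r (1 / 2) with hc₀
  have hc0 : 0 < c₀ := lt_max_of_lt_right (by norm_num)
  have hc1 : c₀ < 1 := max_lt hr (by norm_num)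
  have hrc : r ≤ c₀ := le_max_left _ _
  set c := -Real.log c₀ with hc
  have hcpos : 0 < c := neg_pos.2 (Real.log_neg hc0 hc1)
  set C := K + 1 with hC
  have hC2 : 2 ≤ C := by linarith
  refine ⟨C, c, hcpos, fun L _ W hW x i j R T hij hR1 hT1 hRL hTL => ?_⟩
  have hWt : IsTwistBlind W := hW.isTwistBlind
  have hec : Real.exp (-c) = c₀ := by rw [hc, neg_neg, Real.exp_log hc0]
  by_cases hL : 3 ≤ L
  · have hstep : |W.expectation (fundamentalRep (Fin 2)) β (wilsonLoop (fundamentalRep (Fin 2)) x i j R T)| ≤ (K * r ^ T) ^ R :=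
      su2_abs_wilsonLoop_le_sawRate_pow hn hL hA hlam hcount hr W hWt x hij hRL hTL
    refine hstep.trans ?_
    have h1 : (K * r ^ T) ^ R ≤ K ^ R * c₀ ^ (R * T) := by
      rw [mul_pow, ← pow_mul, mul_comm T R]
      exact mul_le_mul_of_nonneg_left (pow_le_pow_left₀ hr0 hrc _) (pow_nonneg (by linarith) _)
    have h2 : c₀ ^ (R * T) = Real.exp (-c * ((R : ℝ) * T)) := by
      rw [← hec, ← Real.exp_nat_mul]; push_cast; ring_nf
    have h3 : K ^ R ≤ C ^ (2 * (R + T)) := by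
      calc K ^ R ≤ C ^ R := pow_le_pow_left₀ (by linarith) (by linarith) _
        _ ≤ C ^ (2 * (R + T)) := pow_le_pow_right₀ (by linarith) (by omega)
    calc (K * r ^ T) ^ R ≤ K ^ R * c₀ ^ (R * T) := h1
      _ ≤ C ^ (2 * (R + T)) * c₀ ^ (R * T) := mul_le_mul_of_nonneg_right h3 (pow_nonneg hc0.le _)
      _ = C ^ (2 * (R + T)) * Real.exp (-c * ((R : ℝ) * T)) := by rw [h2]
  · -- small torus: `R = T = 1`, `1 ≤ C⁴ e^{−c}` since `C ≥ 2` and `e^{−c} = c₀ ≥ 1/2`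
    have hR : R = 1 := by omega
    have hT : T = 1 := by omega
    subst hR; subst hT
    refine (abs_expectation_wilsonLoop_le_one W β x i j 1 1).trans ?_
    have : Real.exp (-c * (((1 : ℕ) : ℝ) * ((1 : ℕ) : ℝ))) = c₀ := by simpa using hec
    rw [this]
    have hc₀ : 1 / 2 ≤ c₀ := le_max_right _ _
    have hC4 : (16 : ℝ) ≤ C ^ (2 * (1 + 1)) := by
      have := pow_le_pow_left₀ (by norm_num : (0:ℝ) ≤ 2) hC2 4
      norm_num at this ⊢
      exact this
    nlinarith

/-- **EXPLICIT STRING TENSION OF TWIST-BLIND FAMILIES FROM A COUNTING CERTIFICATE** (`SU(2)`, `d = n + 1`, `n ≥ 1`, `β ≠ 0`, `c_ℓ(ℤⁿ) ≤ A λ^ℓ`,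
`A ≥ 1`, `0 < λ`, `r = λ·tanh(2|β|) < 1`, `K = A/(1−r)`): every infinite-volume limit state `μ` of every eventually TWIST-BLIND family (in particular of
every eventually linkwise centre-blind family) obeys `HasAreaLawWith μ χ₂ K (−log r)` and has string tension `σ ≥ −log r` WHENEVER `σ` exists
(existence NOT asserted). [folklore] -/
theorem su2_stringTension_sawRate (hn : 1 ≤ n) {β A lam : ℝ} (hβ : β ≠ 0) (hA : 1 ≤ A) (hlam : 0 < lam)
    (hcount : ∀ ℓ, (count n ℓ : ℝ) ≤ A * lam ^ ℓ) (hr : lam * Real.tanh (2 * |β|) < 1)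
    (𝓦 : PerturbationFamily (n + 1) 2) (h𝓦 : ∀ᶠ L : ℕ in Filter.atTop, IsTwistBlind (𝓦 L)) {μ : Measure (LGConfig (n + 1) (SUN 2))}
    (hμ : μ ∈ perturbedLimitPoints β 𝓦) :
    HasAreaLawWith μ (fun g => normalisedCharacter 2 (fundamentalRep (Fin 2) g)) (A / (1 - lam * Real.tanh (2 * |β|)))
        (-Real.log (lam * Real.tanh (2 * |β|))) ∧
      ∀ σ : ℝ, HasStringTension μ (fun g => normalisedCharacter 2 (fundamentalRep (Fin 2) g)) σ →
        -Real.log (lam * Real.tanh (2 * |β|)) ≤ σ := by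
  have ht0 : 0 < Real.tanh (2 * |β|) := by
    rw [Real.tanh_eq_sinh_div_cosh]
    exact div_pos (Real.sinh_pos_iff.2 (mul_pos two_pos (abs_pos.2 hβ))) (Real.cosh_pos _)
  set r := lam * Real.tanh (2 * |β|) with hrdef
  have hr0 : 0 < r := mul_pos hlam ht0
  have h1r : 0 < 1 - r := by linarith
  set K := A / (1 - r) with hK
  have hK1 : 1 ≤ K := by
    rw [hK, le_div_iff₀ h1r]
    linarith
  have hA : HasAreaLawWith μ (fun g => normalisedCharacter 2 (fundamentalRep (Fin 2) g)) K (-Real.log r) := by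
    refine hasAreaLawWith_of_torusBound (β := β) (fun L => {W : Perturbation (n + 1) (L + 1) 2 | IsTwistBlind W ∧ 2 ≤ L})
      (fun L W hW R T hR hT hRL hTL => ?_) 𝓦 ?_ hμ
    · have hstep : |W.expectation (fundamentalRep (Fin 2)) β
          (wilsonLoop (fundamentalRep (Fin 2)) (0 : Site (n + 1) (L + 1)) 0 1 R T)| ≤ (K * r ^ T) ^ R :=
        su2_abs_wilsonLoop_le_sawRate_pow hn (by have := hW.2; omega) hA hlam.le hcount hr W hW.1 0
          (fin_zero_ne_one_of_two_le (by omega)) hRL hTL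
      refine hstep.trans ?_
      have h2 : Real.exp (-(-Real.log r) * ((R : ℝ) * (T : ℝ))) = r ^ (R * T) := by
        rw [neg_neg, show Real.log r * ((R : ℝ) * (T : ℝ)) = ((R * T : ℕ) : ℝ) * Real.log r by push_cast; ring,
          Real.exp_nat_mul, Real.exp_log hr0]
      rw [h2, mul_pow, ← pow_mul, mul_comm T R]
      exact mul_le_mul_of_nonneg_right (pow_le_pow_right₀ hK1 (by omega)) (pow_nonneg hr0.le _)
    · filter_upwards [h𝓦, Filter.eventually_ge_atTop 2] with L h1 h2 using ⟨h1, h2⟩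
  exact ⟨hA, fun σ hσ => hA.le_of_hasStringTension hσ⟩

/-! ### Row (i): walks without immediate reversals — `(2n−1)·tanh(2|β|) < 1` -/

/-- **`(2n−1)·tanh(2|β|) < 1 ⇒ AreaLawCentreBlind 2 (n+1) β`** (`n ≥ 1`; `d = 4`: `5 tanh β_W < 1`, `β_W < artanh(1/5) = 0.2027`), with
`(C, c) = ((2n/(2n−1))/(1−r) + 1, −log max(r, 1/2))`, `r = (2n−1)·tanh(2|β|)`. [cite: Fisher1967, Phys. Rev. 162 (1967) 480 (tanh(J/kT_c) ≥ 1/(q−1))] -/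
theorem su2_areaLawCentreBlind_sawRate_nonreversing (hn : 1 ≤ n) {β : ℝ} (hr : (((2 * n : ℕ) : ℝ) - 1) * Real.tanh (2 * |β|) < 1) :
    AreaLawCentreBlind 2 (n + 1) β := by
  have h2n : (2 : ℝ) ≤ ((2 * n : ℕ) : ℝ) := by exact_mod_cast (show 2 ≤ 2 * n by omega)
  refine su2_areaLawCentreBlind_sawRate hn (A := ((2 * n : ℕ) : ℝ) / (((2 * n : ℕ) : ℝ) - 1)) ?_ (by linarith)
    (ZTwo.count_le_nonreversing hn) hr
  rw [le_div_iff₀ (by linarith)]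
  linarith

/-- **SU(2), `d = 4`, explicit rate: `5·tanh β_W < 1 ⇒ AreaLawCentreBlind 2 4 β`** (`β_W = 2|β| < artanh(1/5) = 0.2027`; per-rung rate `r = 5 tanh β_W`).
[folklore] -/
theorem su2_areaLawCentreBlind_sawRate_dim4_nonreversing {β : ℝ} (h : 5 * Real.tanh (2 * |β|) < 1) : AreaLawCentreBlind 2 4 β :=
  su2_areaLawCentreBlind_sawRate_nonreversing (n := 3) (by norm_num) (by norm_num; exact h)

/-- **SU(2), `d = 3`, explicit rate: `3·tanh β_W < 1 ⇒ AreaLawCentreBlind 2 3 β`** (`β_W < artanh(1/3) = 0.3466`). [folklore] -/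
theorem su2_areaLawCentreBlind_sawRate_dim3_nonreversing {β : ℝ} (h : 3 * Real.tanh (2 * |β|) < 1) : AreaLawCentreBlind 2 3 β :=
  su2_areaLawCentreBlind_sawRate_nonreversing (n := 2) (by norm_num) (by norm_num; exact h)

/-- **SU(2), `d = 2`: `AreaLawCentreBlind 2 2 β` for EVERY `β`** — in two dimensions the layers are circles, `c_ℓ(ℤ¹) ≤ 2` (the row `(2n−1)·tanh β_W < 1`
with `n = 1` reads `tanh β_W < 1`, always true), and the class confines at every coupling with rate `−log max(tanh(2|β|), 1/2)` — the kernel form of the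
exact two-dimensional area law for the whole centre-blind class. [folklore] -/
theorem su2_areaLawCentreBlind_sawRate_dim2 (β : ℝ) : AreaLawCentreBlind 2 2 β :=
  su2_areaLawCentreBlind_sawRate_nonreversing (n := 1) (by norm_num) (by norm_num; exact Real.tanh_lt_one _)

/-! ### Row (iii): the abstract door `μ(ℤⁿ)·tanh(2|β|) < 1` and the CONDITIONAL Pönitz–Tittmann row -/

/-- **FISHER'S WINDOW FOR THE CLASS: `μ(ℤⁿ)·tanh(2|β|) < 1 ⇒ AreaLawCentreBlind 2 (n+1) β`** (`n ≥ 1`; `μ(ℤⁿ) = SAW.Zd.connectiveConstant n`): since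
`c_ℓ^{1/ℓ} → μ` (tree `tendsto_count_rpow`), every `λ > μ` carries a certificate `c_ℓ ≤ A λ^ℓ`, and `λ` can be taken with `λ·tanh(2|β|) < 1`.  The rate is
explicit in `λ`, the constant `A` is not. [cite: Fisher1967, Phys. Rev. 162 (1967) 480 (tanh(J/kT_c) ≥ 1/μ)] -/
theorem su2_areaLawCentreBlind_of_connectiveConstant_mul_tanh_lt (hn : 1 ≤ n) {β : ℝ}
    (h : connectiveConstant n * Real.tanh (2 * |β|) < 1) : AreaLawCentreBlind 2 (n + 1) β := by
  haveI : NeZero n := ⟨by omega⟩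
  have ht0 : 0 ≤ Real.tanh (2 * |β|) := by
    rw [Real.tanh_eq_sinh_div_cosh]
    exact div_nonneg (Real.sinh_nonneg_iff.2 (by positivity)) (Real.cosh_pos _).le
  have hμ1 : 1 ≤ connectiveConstant n := Literature.Probability.RandomPlanarGeometry.SAW.Zd.one_le_connectiveConstant n
  -- a rate `λ > μ` with `λ t < 1`
  obtain ⟨lam, hμlam, hlamt⟩ : ∃ lam : ℝ, connectiveConstant n < lam ∧ lam * Real.tanh (2 * |β|) < 1 := by
    rcases eq_or_lt_of_le ht0 with ht | ht
    · exact ⟨connectiveConstant n + 1, by linarith, by rw [← ht]; simp⟩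
    · refine ⟨(connectiveConstant n + 1 / Real.tanh (2 * |β|)) / 2, ?_, ?_⟩
      · have : connectiveConstant n < 1 / Real.tanh (2 * |β|) := by rw [lt_div_iff₀ ht]; linarith
        linarith
      · have : (connectiveConstant n + 1 / Real.tanh (2 * |β|)) / 2 * Real.tanh (2 * |β|) =
            (connectiveConstant n * Real.tanh (2 * |β|) + 1) / 2 := by field_simp
        rw [this]; linarith
  have hlam1 : 1 < lam := lt_of_le_of_lt hμ1 hμlam
  -- eventually `c_ℓ ≤ λ^ℓ`
  have hev : ∀ᶠ ℓ : ℕ in Filter.atTop, (count n ℓ : ℝ) ≤ lam ^ ℓ := by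
    have h1 := (Literature.Probability.RandomPlanarGeometry.SAW.Zd.tendsto_count_rpow n).eventually (gt_mem_nhds hμlam)
    filter_upwards [h1, Filter.eventually_ge_atTop 1] with ℓ hℓ hℓ1
    have hc0 : (0 : ℝ) ≤ count n ℓ := Nat.cast_nonneg _
    have hℓ0 : (ℓ : ℝ) ≠ 0 := by exact_mod_cast (show ℓ ≠ 0 by omega)
    calc (count n ℓ : ℝ) = ((count n ℓ : ℝ) ^ (1 / (ℓ : ℝ))) ^ ℓ := by
          rw [← Real.rpow_natCast, ← Real.rpow_mul hc0, one_div_mul_cancel hℓ0, Real.rpow_one]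
      _ ≤ lam ^ ℓ := pow_le_pow_left₀ (Real.rpow_nonneg hc0 _) hℓ.le ℓ
  obtain ⟨ℓ₀, hℓ₀⟩ := Filter.eventually_atTop.1 hev
  -- the certificate `c_ℓ ≤ A λ^ℓ` with `A = 1 + ∑_{ℓ < ℓ₀} c_ℓ`
  set A : ℝ := 1 + ∑ ℓ ∈ Finset.range ℓ₀, (count n ℓ : ℝ) with hAdef
  have hA1 : 1 ≤ A := by
    rw [hAdef]; linarith [Finset.sum_nonneg (fun ℓ (_ : ℓ ∈ Finset.range ℓ₀) => (Nat.cast_nonneg (count n ℓ) : (0 : ℝ) ≤ count n ℓ))]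
  refine su2_areaLawCentreBlind_sawRate hn hA1 (by linarith) (fun ℓ => ?_) hlamt
  have hpow1 : 1 ≤ lam ^ ℓ := one_le_pow₀ hlam1.le
  rcases lt_or_ge ℓ ℓ₀ with hlt | hge
  · have hle : (count n ℓ : ℝ) ≤ A := by
      rw [hAdef]
      have := Finset.single_le_sum (fun m (_ : m ∈ Finset.range ℓ₀) => (Nat.cast_nonneg (count n m) : (0 : ℝ) ≤ count n m))
        (Finset.mem_range.2 hlt)
      linarith
    calc (count n ℓ : ℝ) ≤ A := hle
      _ = A * 1 := (mul_one A).symm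
      _ ≤ A * lam ^ ℓ := mul_le_mul_of_nonneg_left hpow1 (by linarith)
  · calc (count n ℓ : ℝ) ≤ lam ^ ℓ := hℓ₀ ℓ hge
      _ = 1 * lam ^ ℓ := (one_mul _).symm
      _ ≤ A * lam ^ ℓ := mul_le_mul_of_nonneg_right hA1 (by positivity)

/-- **CONDITIONAL ROW (Pönitz–Tittmann as printed): `μ(ℤ³) ≤ 4.7387 → 4.7387·tanh(2|β|) < 1 → AreaLawCentreBlind 2 4 β`** (`β_W < artanh(1/4.7387) =
0.214247…`).  CONDITIONAL on the named fact `PT2000_connectiveConstant_three_le` (the memory-14 automaton bound, certified in the source, UNPROVED in the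
tree; the unconditional kernel value is `4.76`, `su2_areaLawCentreBlind_sawRate_dim4_memTen`). [cite: PonitzTittmann2000, §1 p. 2 and Table 2 (d = 3, k = 14)] -/
theorem su2_areaLawCentreBlind_sawRate_dim4_of_PT2000
    (hPT : Literature.Probability.RandomPlanarGeometry.SAW.Zd.PT2000_connectiveConstant_three_le) {β : ℝ}
    (h : 4.7387 * Real.tanh (2 * |β|) < 1) : AreaLawCentreBlind 2 4 β := by
  have ht0 : 0 ≤ Real.tanh (2 * |β|) := by
    rw [Real.tanh_eq_sinh_div_cosh]
    exact div_nonneg (Real.sinh_nonneg_iff.2 (by positivity)) (Real.cosh_pos _).le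
  refine su2_areaLawCentreBlind_of_connectiveConstant_mul_tanh_lt (n := 3) (by norm_num) ?_
  exact (mul_le_mul_of_nonneg_right hPT ht0).trans_lt h

end Summit.Ventures.YMGap.RobustBall

end
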